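import Literature.MathematicalPhysics.QuantumFieldTheory.Balaban1983to89.Node00.OpsYDeltaPrimeA
import Literature.MathematicalPhysics.QuantumFieldTheory.Balaban1983to89.B9Thm311DeltaPrimeSymm
import Literature.MathematicalPhysics.QuantumFieldTheory.Balaban1983to89.B9Eq360VprimeLetters

/-!
# `Balaban1983to89.B9Eq360DeltaPrimeAY` — (3.60) AT NODE 00's GENUINE `Δ′_a(U)`: the EXACT operator identity
# `Δ′_a(U′U) = Δ′_a(U) − V′(A′)` for `U′ = e^{iηA′}`, with r06's concrete `V′(A′) = V′₁(A′) − (F′₂*aQ′ + Q′*aF′₂ + F′₂*aF′₂)`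
# (`B9Eq360VprimeLetters.vPrimeConc`), and THE AVERAGING LETTERS `kQY sQY kFY sFY cY` of NODE 00's operator read in r06's block model

T. Bałaban, *Propagators for lattice gauge theories in a background field*, Commun. Math. Phys. **99** (1985) 389–434
[`Balaban1985BackgroundPropagators`, "B9"]; [4] = T. Bałaban, *Propagators and renormalization transformations for lattice gauge
theories. II*, Commun. Math. Phys. **96** (1984) 223–250 [`Balaban1984PropagatorsII`].

statement-level skeleton of published theorems with citation tags; proofs where landed; nothing here is a claim about the
Yang–Mills mass gap

THE PRINTED LOCUS (verbatim, p. 402): *"Combining (3.53) and (3.59) we get Δ_{U′U} + Q′\*(U′U)aQ′(U′U) = Δ_U + Q′\*(U)aQ′(U) − V′₁(A)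
+ F′₂\*(A)aQ′(U) + Q′\*(U)aF′₂(A) + F′₂\*(A)aF′₂(A) = Δ_U + Q′\*(U)aQ′(U) − V′(A), (3.60) where the operator V′(A) is defined by the last
equality."*; (3.53) p. 400: *"Δ_{U′U} = Δ_U − V′₁(A)"*; (3.57) p. 401: *"Q′_j(U′U)λ = Q′_j(U)λ + F′_{2,j}(A)λ"*; (3.59) p. 402: *"We have a
similar expansion for the adjoint operator"*; (3.24) p. 394: *"Δ′_a = Δ′_a(U) = (Δ^η_U + Q′\*aQ′)|_{Ω₀}"*; (3.19) p. 393: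
*"(Q′_j(U)λ)(y) = Σ_{x∈B^j(y)} L^{−jd} R(U(Γ^{(j)}_{y,x})) λ(x)"*.

WHY THIS FILE (pub-ymgap N06 row 13, seat dag-n06-c gen 7; the FIRST file of the row-13 INSTANCE).  The Sect.-B letters dictionaries
(`B9SectBGpStepAtLettersV2.GpFrame₂` …) ask, as the exact algebraic law `mul_law`, that the instance's letter `Δp(U′U)` equal
`Δp(U) − conj b (vPrimeConc T (coord U) η (expA U U′) blk kQ kF sQ sF cfun)` on the class (3.37) — r06's CONCRETE `V′(A′)` of (3.60) in
letters `kQ kF sQ sF cfun` the instance supplies.  NODE 00's genuine operator is `Node00.deltaPrimeAY i par U = lapSL i U + kernelTrOpY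
(avgCoeffY i) (avgTrY i par U)` (def-Y, `Node00.OpsYDeltaPrimeA`): the covariant Laplacian in lattice units plus the transported collapsed
averaging kernel `Σ_w levC_{j(z)}[w ∼ z]·R(U(Γ_{z,c})U(Γ_{c,w}))`.  This file proves the law for it, EXACTLY, for EVERY configuration `U`,
EVERY field `A′` and EVERY transporter table `par` (no regularity, no smallness — pure algebra):
* §1 `Rclm u` (`R(u)` as an `ℝ`-continuous-linear letter), additivity of r06's words `kerOp`/`liftOp` in their letters, and ★
  `word_sub_word_eq_avgOp`: `L[sQ+sF]·a·K[kQ+kF] − L[sQ]·a·K[kQ] = avgOp …` — the bilinear expansion print performs in (3.60);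
* §2 the LETTERS `blkY` (NODE 00's block map `𝔅`), `kQY par U s w := W_s⁻¹·R(U(Γ_{c_s,w}))` ((3.19)'s kernel), `sQY par U z :=
  R(U(Γ_{z,c_{s(z)}}))` (Q′\*), `cY s := levC_{j(s)}·W_s` (the weight `a`, lattice units), and ★ `avgTerm_eq_word`: NODE 00's averaging term
  IS r06's word `L[sQY]·diag(cY)·K[kQY]` (as `ℝ`-linear operators; n06-j's `avgCoeffY_eq_ite`, `cornerY_levY_eq` by name);
* §3 `mulY` (the product `U′U` = `bg9K.mul`), `chartA` (A′ on the box chart), `UboxY_mulY_fluct` (on the chart `e^{iηA′}U` IS r06's `prodCfg U η A`,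
  `rfl`), `lapS_eq_smul_siteLap` (NODE 00's Laplacian = `η²`·r06's (3.23)), ★ `lapS_mulY_fluct` ∕ `lapSL_mulY_fluct`: (3.53) `Δ_{U′U} = Δ_U −
  η²V′₁(A)` for NODE 00's Laplacian — r06's `B9Eq352ScalarFluct.eq353` + `B9Eq352GradLetters.V1pOp_apply` BY NAME;
* §4 the variation letters `kFY := kQY(U′U) − kQY(U)`, `sFY := sQY(U′U) − sQY(U)` ((3.57)∕(3.59) as DEFINITIONS — print's F′₂, F′₂\*), ★★
  `deltaPrimeAY_mulY_fluct`: `Δ′_a(U′U) = Δ′_a(U) − (η²V′₁(A) − avgOp …)` and ★★ `eq360_deltaPrimeAY`: the frames' shape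
  `η⁻²Δ′_a(U′U) = η⁻²Δ′_a(U) − vPrimeConc (shiftY i) (UboxY i U) η (chartA i A′) blkY kQY kFY sQY sFY (η⁻²·cY)` (`η ≠ 0`);
* §5 relabeling: `avgOp`∕`vPrimeConc` are invariant under an injective relabeling of the blocks (`kerOp_reindex`, `avgOp_reindex`,
  `vPrimeConc_reindex`) — the frames index blocks by `(geo i).Site`, an injective image of `𝔅`.

HONEST SCOPE.  Exact finite-dimensional algebra about NODE 00's DEFINED operator and r06's DEFINED letters; NO estimate ((3.58), (3.61) are not
touched: the sizes of `kFY`, `sFY` under (3.37) are the instance's next file); nothing of [B9] is asserted; COUNT-NEUTRAL; N06 NOT discharged; one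
finite lattice programme — nothing continuum ∕ OS ∕ mass-gap ∕ Clay.  NODE 00's modelling limits of `Δ′_a(U)` (corner reference point, taxicab
contours, no `Ω₀`-restriction; `Node00.OpsYDeltaPrimeA` HONEST LIMITS) are inherited, not altered.  Cell `pub-ymgap` (HUMAN RULING D-0062), Track A
node N06 [B9], N06-ASSIGNMENT row 13, 2026-08-27.

RELATED IN THE TREE, NOT DUPLICATED: `Node00.OpsYDeltaPrimeA` (`deltaPrimeAY`, `kernelTrOpY`, `avgTrY`, `avgCoeffY`, `cornerY`, `lapSL`), `Node00.OpsYDeltaA`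
(`blkCornerY`, `RL`), `B9Thm311ReadingAtLetters` (`wB`), `B9Thm311DeltaPrimeSymm` (`avgCoeffY_eq_ite`, `cornerY_levY_eq`), r06's `B9Eq39Adjoint`,
`B9Eq352ScalarFluct` (`eq353`), `B9Eq352GradLetters` (`V1pOp`), `B9Eq360Vprime` (`kerOp`, `liftOp`, `diagOp`, `block`), `B9Eq360VprimeLetters` (`avgOp`,
`vPrimeConc`) — USED BY NAME; no existing module modified.
-/

noncomputable section

namespace Literature.MathematicalPhysics.QuantumFieldTheory.Balaban1983to89.B9Eq360DeltaPrimeAY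

open Literature.MathematicalPhysics.QuantumFieldTheory.Balaban1983to89.B9Eq39Adjoint (R R_add R_sub R_smul R_mul covD covDstar fluct prodCfg)
open Literature.MathematicalPhysics.QuantumFieldTheory.Balaban1983to89.B9Eq352ScalarFluct (siteLap eq353)
open Literature.MathematicalPhysics.QuantumFieldTheory.Balaban1983to89.B9Eq352GradLetters (V1pOp V1pOp_apply)
open Literature.MathematicalPhysics.QuantumFieldTheory.Balaban1983to89.B9Eq360Vprime (kerOp liftOp diagOp kerOp_apply liftOp_apply diagOp_apply mem_block)
open Literature.MathematicalPhysics.QuantumFieldTheory.Balaban1983to89.B9Eq360VprimeLetters (vPrimeConc vPrimeConc_eq)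
open Literature.MathematicalPhysics.QuantumFieldTheory.Balaban1983to89.B6KLevelCensusIndexV1 (KIdx)
open Literature.MathematicalPhysics.QuantumFieldTheory.Balaban1983to89.B6Geom246MultiLevelBox (bset blkOf lev_eq_of_blkOf_eq)
open Literature.MathematicalPhysics.QuantumFieldTheory.Balaban1983to89.B6GlobalChartV1 (boxEquiv)
open Literature.MathematicalPhysics.QuantumFieldTheory.Balaban1983to89.B6MultiLevelBoxOperator (levC aPrinted)
open Literature.MathematicalPhysics.QuantumFieldTheory.Balaban1983to89.B9Thm311ReadingAtLetters (wB wB_pos)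
open Literature.MathematicalPhysics.QuantumFieldTheory.Balaban1983to89.B9Thm311DeltaPrimeSymm (avgCoeffY_eq_ite cornerY_levY_eq)
open Literature.MathematicalPhysics.QuantumFieldTheory.Balaban1983to89.Node00 (SiteY BlkY CfgY SiteParY UboxY shiftY cdS cdsS lapS lapSL kernelTrOpY kernelTrOpY_apply avgCoeffY avgTrY cornerY levY
  blkCornerY deltaPrimeAY)

variable {d ℓ : ℕ} {hd : 1 ≤ d + 1} {hL : Odd (ℓ + 1) ∧ 1 < ℓ + 1} {b₀ b₁ : ℝ}
variable {𝔸 : Type} [NormedRing 𝔸] [NormedAlgebra ℂ 𝔸] [CompleteSpace 𝔸]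

/-! ## §1 The adjoint action as an `ℝ`-continuous-linear letter; additivity of the block-model words -/

/-- `R(u) : X ↦ uXu⁻¹` as a continuous `ℝ`-linear map of `𝔸` (the shape r06's block model takes its transports in).
[cite: Balaban1985BackgroundPropagators, (3.1) p.390 («R(U)X = UXU⁻¹»), (3.19) p.393] -/
def Rclm (u : 𝔸ˣ) : 𝔸 →L[ℝ] 𝔸 := ContinuousLinearMap.mulLeftRight ℝ 𝔸 (u : 𝔸) ((u⁻¹ : 𝔸ˣ) : 𝔸)

omit [CompleteSpace 𝔸] in
/-- `Rclm u X = R u X`. [cite: Balaban1985BackgroundPropagators, (3.1) p.390, bookkeeping] -/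
@[simp] theorem Rclm_apply (u : 𝔸ˣ) (X : 𝔸) : Rclm u X = R u X := by
  simp [Rclm, R]


section Words

variable {X 𝔅 : Type*} [Fintype X] [DecidableEq 𝔅] {E : Type*} [NormedAddCommGroup E] [NormedSpace ℝ E]

/-- the kernel word is additive in its kernel letter: `K[k + k′] = K[k] + K[k′]` (so `Q′(U′U) = Q′(U) + F′₂` with `F′₂ := K[kQ(U′U) − kQ(U)]`).
[cite: Balaban1985BackgroundPropagators, (3.57)–(3.59) pp.401–402, bookkeeping] -/
theorem kerOp_add (blk : X → 𝔅) (k k' : 𝔅 → X → E →L[ℝ] E) : kerOp blk (k + k') = kerOp blk k + kerOp blk k' := by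
  refine LinearMap.ext fun μ => funext fun y => ?_
  simp only [kerOp_apply, LinearMap.add_apply, Pi.add_apply, _root_.add_apply, Finset.sum_add_distrib]

omit [Fintype X] [DecidableEq 𝔅] in
/-- the starred word is additive in its letter: `L[s + s′] = L[s] + L[s′]` (`Q′*(U′U) = Q′*(U) + F′₂*`).
[cite: Balaban1985BackgroundPropagators, (3.59) p.402 («a similar expansion for the adjoint operator»), bookkeeping] -/
theorem liftOp_add (blk : X → 𝔅) (s s' : X → E →L[ℝ] E) : liftOp blk (s + s') = liftOp blk s + liftOp blk s' := by
  refine LinearMap.ext fun ν => funext fun x => ?_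
  simp only [liftOp_apply, LinearMap.add_apply, Pi.add_apply, _root_.add_apply]

/-- **THE BILINEAR EXPANSION BEHIND (3.60)**: `Q′*(U′U)aQ′(U′U) − Q′*(U)aQ′(U) = F′₂*aQ′(U) + Q′*(U)aF′₂ + F′₂*aF′₂` with `F′₂ := Q′(U′U) − Q′(U)`,
`F′₂* := Q′*(U′U) − Q′*(U)` — in r06's block model: `L[sQ + sF]·a·K[kQ + kF] − L[sQ]·a·K[kQ] = avgOp blk kQ kF sQ sF c`.
[cite: Balaban1985BackgroundPropagators, (3.60) p.402 («Combining (3.53) and (3.59) we get …»)] -/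
theorem word_sub_word_eq_avgOp (blk : X → 𝔅) (kQ kF : 𝔅 → X → E →L[ℝ] E) (sQ sF : X → E →L[ℝ] E) (c : 𝔅 → ℝ) :
    liftOp blk (sQ + sF) ∘ₗ diagOp c ∘ₗ kerOp blk (kQ + kF) - liftOp blk sQ ∘ₗ diagOp c ∘ₗ kerOp blk kQ
      = B9Eq360VprimeLetters.avgOp blk kQ kF sQ sF c := by
  rw [kerOp_add, liftOp_add, B9Eq360VprimeLetters.avgOp]
  simp only [LinearMap.add_comp, LinearMap.comp_add]
  abel

end Words

/-! ## §2 NODE 00's averaging term `Σ_j a_j(Lʲη)⁻² Q′_j(U)*1_{Λ_j}Q′_j(U)` IN r06's BLOCK MODEL: the letters `kQY sQY cY` -/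

section Letters

variable (i : KIdx d ℓ hd hL b₀ b₁) (par : SiteParY 𝔸 i)

/-- the block map `𝔅` of NODE 00's carrier: the block of the multilevel partition containing a site (typed on `SiteY i`).
[cite: Balaban1985BackgroundPropagators, p.397 («y ∈ 𝔅 = ⋃_j Λ_j … Δ(y) = B^j(y)»), dictionary] -/
def blkY : SiteY i → BlkY i := fun z => blkOf i.D.toDomains z

omit [NormedRing 𝔸] [NormedAlgebra ℂ 𝔸] [CompleteSpace 𝔸] in
/-- `blkY`, evaluated. [cite: Balaban1985BackgroundPropagators, p.397, bookkeeping] -/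
@[simp] theorem blkY_apply (z : SiteY i) : blkY i z = blkOf i.D.toDomains z := rfl

/-- **the kernel letter of `Q′(U)`** in r06's block model ((3.19): `(Q′_j(U)λ)(y) = Σ_{x∈Bʲ(y)} L^{−jd}R(U(Γ_{y,x}))λ(x)`), at NODE 00's letters:
`kQ(s, w) = W_s⁻¹ · R(U(Γ_{c_s, w}))` — block volume `W_s`, contour from the block's corner `c_s` (`Node00.blkCornerY`) along the transporter table `par`.
[cite: Balaban1985BackgroundPropagators, (3.19) p.393] -/
def kQY (U : CfgY 𝔸 i) : BlkY i → SiteY i → 𝔸 →L[ℝ] 𝔸 := fun s w => (wB i s)⁻¹ • Rclm (par U (blkCornerY i s) w)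

/-- **the letter of `Q′*(U)`** in r06's block model: `sQ(z) = R(U(Γ_{z, c_{s(z)}}))` (transport from the corner of the block of `z` to `z`).
[cite: Balaban1985BackgroundPropagators, (3.24) p.394 (Q′*), (3.19) p.393] -/
def sQY (U : CfgY 𝔸 i) : SiteY i → 𝔸 →L[ℝ] 𝔸 := fun z => Rclm (par U z (blkCornerY i (blkY i z)))

/-- **the weight letter `a` per block of `𝔅`, lattice units**: `c(s) = levC_{j(s)}·W_s` (`levC_j = a_j L^{−2j} L^{−j(d+1)}`, NODE 00's collapsed coefficient
of `Q′*aQ′`; `W_s` the block volume). [cite: Balaban1985BackgroundPropagators, (3.24) p.394; Balaban1984PropagatorsII, (2.14) p.225] -/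
def cY : BlkY i → ℝ := fun s => levC d ℓ (aPrinted ℓ 1) s.1.1 * wB i s

/-- `kQ(s, w)` applied. [cite: Balaban1985BackgroundPropagators, (3.19) p.393, bookkeeping] -/
@[simp] theorem kQY_apply (U : CfgY 𝔸 i) (s : BlkY i) (w : SiteY i) (X : 𝔸) :
    kQY i par U s w X = (wB i s)⁻¹ • R (par U (blkCornerY i s) w) X := by
  simp [kQY]

/-- `sQ(z)` applied. [cite: Balaban1985BackgroundPropagators, (3.24) p.394, bookkeeping] -/
@[simp] theorem sQY_apply (U : CfgY 𝔸 i) (z : SiteY i) (X : 𝔸) :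
    sQY i par U z X = R (par U z (blkCornerY i (blkY i z))) X := by
  simp [sQY]

/-- ★ **NODE 00's AVERAGING TERM IS r06's WORD `Q′*(U)·a·Q′(U)`**: `Σ_w avgCoeffY(z,w)·R(U(Γ_{z,c})U(Γ_{c,w}))Φ(w) = (L[sQ]·a·K[kQ] Φ)(z)` — the transported
collapsed kernel of `Node00.deltaPrimeAY` read in the block model of `B9Eq360Vprime` with the letters `kQY`, `sQY`, `cY` (as `ℝ`-linear operators).
[cite: Balaban1985BackgroundPropagators, (3.19) p.393, (3.24) p.394; Balaban1984PropagatorsII, (2.13)–(2.14) p.225] -/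
theorem avgTerm_eq_word (U : CfgY 𝔸 i) :
    (kernelTrOpY (avgCoeffY i) (avgTrY i par U)).restrictScalars ℝ
      = liftOp (blkY i) (sQY i par U) ∘ₗ diagOp (cY i) ∘ₗ kerOp (blkY i) (kQY i par U) := by
  refine LinearMap.ext fun Φ => funext fun z => ?_
  set s : BlkY i := blkY i z with hs
  have hlev : levY i z = s.1.1 := by
    change i.D.toDomains.lev z.1 = s.1.1
    exact lev_eq_of_blkOf_eq i.D.toDomains rfl
  have hcorner : cornerY i (levY i z) z = blkCornerY i s := cornerY_levY_eq i z
  have hcoef : ∀ w : SiteY i, avgCoeffY i z w = if blkY i w = s then levC d ℓ (aPrinted ℓ 1) s.1.1 else 0 := fun w => by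
    rw [avgCoeffY_eq_ite, hlev]
    exact if_congr Iff.rfl rfl rfl
  -- the right-hand side, unfolded at `z`: `sQ(z)(c(s) • Σ_{w∈s} kQ(s,w)Φ(w))`
  show kernelTrOpY (avgCoeffY i) (avgTrY i par U) Φ z
    = sQY i par U z (cY i s • ∑ w ∈ B9Eq360Vprime.block (blkY i) s, kQY i par U s w (Φ w))
  have hR : ∀ (u : 𝔸ˣ) (f : SiteY i → 𝔸), R u (∑ w ∈ B9Eq360Vprime.block (blkY i) s, f w)
      = ∑ w ∈ B9Eq360Vprime.block (blkY i) s, R u (f w) :=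
    fun u f => map_sum (Node00.RL u) f _
  rw [kernelTrOpY_apply, sQY_apply, ← hs]
  calc ∑ w, ((avgCoeffY i z w : ℝ) : ℂ) • R (avgTrY i par U z w) (Φ w)
      = ∑ w, if blkY i w = s then
          ((levC d ℓ (aPrinted ℓ 1) s.1.1 : ℝ) : ℂ) • R (par U z (blkCornerY i s)) (R (par U (blkCornerY i s) w) (Φ w)) else 0 := by
        refine Finset.sum_congr rfl fun w _ => ?_
        rw [hcoef, avgTrY, hcorner, B9Eq39Adjoint.R_mul]
        split_ifs
        · rfl
        · rw [Complex.ofReal_zero, zero_smul]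
    _ = ∑ w ∈ B9Eq360Vprime.block (blkY i) s,
          ((levC d ℓ (aPrinted ℓ 1) s.1.1 : ℝ) : ℂ) • R (par U z (blkCornerY i s)) (R (par U (blkCornerY i s) w) (Φ w)) := by
        rw [B9Eq360Vprime.block, Finset.sum_filter]
    _ = R (par U z (blkCornerY i s)) (cY i s • ∑ w ∈ B9Eq360Vprime.block (blkY i) s, kQY i par U s w (Φ w)) := by
        rw [R_smul, hR, Finset.smul_sum]
        refine Finset.sum_congr rfl fun w _ => ?_
        simp only [kQY_apply, R_smul, smul_smul, cY, mul_assoc, mul_inv_cancel₀ (wB_pos i s).ne', mul_one, Complex.coe_smul]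

end Letters

/-! ## §3 The product configuration `U′U`, `U′ = e^{iηA′}`, on NODE 00's chart; the Laplacian part of (3.60) via (3.53) -/

section Product

variable (i : KIdx d ℓ hd hL b₀ b₁)

/-- the product configuration `U′U` of the record's carrier (`(bg9K 𝔸 G i).mul U′ U`, definitionally): `(U′U)(b) = U′(b)·U(b)`.
[cite: Balaban1985BackgroundPropagators, Thm 3.4 p.400 («configurations U′U»), dictionary] -/
def mulY (U' U : CfgY 𝔸 i) : CfgY 𝔸 i := fun μ x => U' μ x * U μ x

variable (𝔸) in
/-- the type of the fields `A′` of (3.37) at the member (bond functions of the torus with values in `𝔸`).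
[cite: Balaban1985BackgroundPropagators, (3.37) p.396, dictionary] -/
abbrev AfldY : Type := Fin (d + 1) → Site (B6GlobalChartV1.PV d ℓ i.m i.K hd hL) 0 → 𝔸

/-- the field `A′` read on NODE 00's box chart: `A(μ, z) = A′(μ, chart⁻¹ z)`. [cite: Balaban1985BackgroundPropagators, (3.37) p.396, dictionary] -/
def chartA (A' : AfldY 𝔸 i) : Fin (d + 1) → SiteY i → 𝔸 := fun μ z => A' μ ((boxEquiv i.hN).symm z)

omit [NormedRing 𝔸] [NormedAlgebra ℂ 𝔸] [CompleteSpace 𝔸] in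
/-- `chartA`, evaluated. [cite: Balaban1985BackgroundPropagators, (3.37) p.396, bookkeeping] -/
@[simp] theorem chartA_apply (A' : AfldY 𝔸 i) (μ : Fin (d + 1)) (z : SiteY i) : chartA i A' μ z = A' μ ((boxEquiv i.hN).symm z) := rfl

/-- ON THE CHART, `U′U` with `U′ = e^{iηA′}` IS r06's `prodCfg U η A` of (3.50): `(e^{iηA′}U)_μ(z) = e^{iηA(μ,z)}·U_μ(z)`.
[cite: Balaban1985BackgroundPropagators, (3.50) p.400 («R(U′(x, x+ηe_μ))R(U(x, x+ηe_μ))»), (3.37) p.396] -/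
theorem UboxY_mulY_fluct (η : ℝ) (A' : AfldY 𝔸 i) (U : CfgY 𝔸 i) :
    UboxY i (mulY i (fluct η A') U) = prodCfg (UboxY i U) η (chartA i A') := rfl

/-- NODE 00's lattice-unit Laplacian is `η²` times r06's (3.23) Laplacian at the charted letters (`η ≠ 0`):
`(Δ_UΦ)(z) = η²·(Δ^η_UΦ)(z)`. [cite: Balaban1985BackgroundPropagators, (3.23) p.394] -/
theorem lapS_eq_smul_siteLap {η : ℝ} (hη : η ≠ 0) (U : CfgY 𝔸 i) (Φ : SiteY i → 𝔸) (z : SiteY i) :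
    lapS i U Φ z = ((η : ℂ) ^ 2) • siteLap (shiftY i) (UboxY i U) η Φ z := by
  have hη' : (η : ℂ) ≠ 0 := Complex.ofReal_ne_zero.mpr hη
  rw [siteLap, smul_smul, ← mul_pow, mul_inv_cancel₀ hη', one_pow, one_smul]
  rfl

/-- ★ **(3.53) FOR NODE 00's LAPLACIAN**: `Δ_{U′U} = Δ_U − η²·V′₁(A)` on the chart (`U′ = e^{iηA′}`, `A = chartA A′`; lattice units; `η ≠ 0`) —
r06's `B9Eq352ScalarFluct.eq353` and `B9Eq352GradLetters.V1pOp_apply`, pointwise. [cite: Balaban1985BackgroundPropagators, (3.53) p.400, (3.50)–(3.52) p.400] -/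
theorem lapS_mulY_fluct {η : ℝ} (hη : η ≠ 0) (A' : AfldY 𝔸 i) (U : CfgY 𝔸 i) (Φ : SiteY i → 𝔸) (z : SiteY i) :
    lapS i (mulY i (fluct η A') U) Φ z = lapS i U Φ z - ((η : ℂ) ^ 2) • V1pOp (shiftY i) (UboxY i U) η (chartA i A') Φ z := by
  rw [lapS_eq_smul_siteLap i hη, lapS_eq_smul_siteLap i hη, UboxY_mulY_fluct, eq353, V1pOp_apply _ _ η hη, smul_sub]

/-- ★ (3.53) AS `ℝ`-LINEAR OPERATORS on NODE 00's carrier: `Δ_{U′U} = Δ_U − η²·V′₁(A)`. [cite: Balaban1985BackgroundPropagators, (3.53) p.400] -/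
theorem lapSL_mulY_fluct {η : ℝ} (hη : η ≠ 0) (A' : AfldY 𝔸 i) (U : CfgY 𝔸 i) :
    (lapSL i (mulY i (fluct η A') U)).restrictScalars ℝ
      = (lapSL i U).restrictScalars ℝ - (η ^ 2 : ℝ) • V1pOp (shiftY i) (UboxY i U) η (chartA i A') := by
  refine LinearMap.ext fun Φ => funext fun z => ?_
  rw [LinearMap.restrictScalars_apply, Node00.lapSL_apply, lapS_mulY_fluct i hη, LinearMap.sub_apply, LinearMap.restrictScalars_apply,
    Node00.lapSL_apply, LinearMap.smul_apply, Pi.sub_apply, Pi.smul_apply, ← Complex.coe_smul, Complex.ofReal_pow]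

end Product

/-! ## §4 ★★ (3.60) for NODE 00's `Δ′_a(U)` -/

section Main

variable (i : KIdx d ℓ hd hL b₀ b₁) (par : SiteParY 𝔸 i)

/-- **the variation letter `F′₂(A′)` of `Q′`** ((3.57): `Q′(U′U) = Q′(U) + F′₂(A′)`), in r06's block model: `kF := kQ(U′U) − kQ(U)`.
[cite: Balaban1985BackgroundPropagators, (3.57)–(3.58) pp.401–402] -/
def kFY (U U'U : CfgY 𝔸 i) : BlkY i → SiteY i → 𝔸 →L[ℝ] 𝔸 := fun s w => kQY i par U'U s w - kQY i par U s w

/-- **the variation letter `F′₂*(A′)` of `Q′*`** ((3.59) «a similar expansion for the adjoint operator»): `sF := sQ(U′U) − sQ(U)`.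
[cite: Balaban1985BackgroundPropagators, (3.59) p.402] -/
def sFY (U U'U : CfgY 𝔸 i) : SiteY i → 𝔸 →L[ℝ] 𝔸 := fun z => sQY i par U'U z - sQY i par U z

/-- (3.57) for the kernel letter: `kQ(U′U) = kQ(U) + kF`. [cite: Balaban1985BackgroundPropagators, (3.57) p.401, bookkeeping] -/
theorem kQY_eq_add (U U'U : CfgY 𝔸 i) : kQY i par U'U = kQY i par U + kFY i par U U'U := by
  funext s w; simp [kFY]

/-- (3.59) for the starred letter: `sQ(U′U) = sQ(U) + sF`. [cite: Balaban1985BackgroundPropagators, (3.59) p.402, bookkeeping] -/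
theorem sQY_eq_add (U U'U : CfgY 𝔸 i) : sQY i par U'U = sQY i par U + sFY i par U U'U := by
  funext z; simp [sFY]

/-- ★★ **(3.60) FOR NODE 00's GENUINE `Δ′_a(U)`, EXACTLY, lattice units** (`U′ = e^{iηA′}`, `η ≠ 0`, ANY `U`, ANY `A′`, any transporter table `par`):
`Δ′_a(U′U) = Δ′_a(U) − (η²·V′₁(A) − (F′₂*aQ′(U) + Q′*(U)aF′₂ + F′₂*aF′₂))` as `ℝ`-linear operators on NODE 00's site carrier, with r06's CONCRETE
`V′₁(A) = B9Eq352GradLetters.V1pOp (shiftY i) (UboxY i U) η (chartA i A′)` of (3.52) and the averaging words `B9Eq360VprimeLetters.avgOp` in the letters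
`kQY`, `kFY`, `sQY`, `sFY`, `cY` — print's *"Combining (3.53) and (3.59) we get Δ_{U′U} + Q′\*(U′U)aQ′(U′U) = … = Δ_U + Q′\*(U)aQ′(U) − V′(A) (3.60)"*.
[cite: Balaban1985BackgroundPropagators, (3.60) p.402, (3.53) p.400, (3.57)–(3.59) pp.401–402, (3.24) p.394] -/
theorem deltaPrimeAY_mulY_fluct {η : ℝ} (hη : η ≠ 0) (A' : AfldY 𝔸 i) (U : CfgY 𝔸 i) :
    (deltaPrimeAY i par (mulY i (fluct η A') U)).restrictScalars ℝ
      = (deltaPrimeAY i par U).restrictScalars ℝ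
        - ((η ^ 2 : ℝ) • V1pOp (shiftY i) (UboxY i U) η (chartA i A')
          - B9Eq360VprimeLetters.avgOp (blkY i) (kQY i par U) (kFY i par U (mulY i (fluct η A') U)) (sQY i par U)
              (sFY i par U (mulY i (fluct η A') U)) (cY i)) := by
  rw [Node00.deltaPrimeAY, Node00.deltaPrimeAY, LinearMap.restrictScalars_add, LinearMap.restrictScalars_add, lapSL_mulY_fluct i hη,
    avgTerm_eq_word, avgTerm_eq_word, kQY_eq_add i par U (mulY i (fluct η A') U), sQY_eq_add i par U (mulY i (fluct η A') U),
    ← word_sub_word_eq_avgOp]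
  abel

/-- the weight operator is linear in the weight letter. [cite: Balaban1985BackgroundPropagators, (3.24) p.394, bookkeeping] -/
theorem diagOp_smul {𝔅 : Type*} {E : Type*} [NormedAddCommGroup E] [NormedSpace ℝ E] (r : ℝ) (c : 𝔅 → ℝ) :
    (diagOp (r • c) : (𝔅 → E) →ₗ[ℝ] (𝔅 → E)) = r • diagOp c := by
  refine LinearMap.ext fun ν => funext fun y => ?_
  simp only [diagOp_apply, Pi.smul_apply, LinearMap.smul_apply, smul_eq_mul, mul_smul]

/-- the averaging words are linear in the weight letter: `avgOp … (r•c) = r • avgOp … c`. [cite: Balaban1985BackgroundPropagators, (3.60) p.402, bookkeeping] -/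
theorem avgOp_smul_weight {X 𝔅 : Type*} [Fintype X] [DecidableEq 𝔅] {E : Type*} [NormedAddCommGroup E] [NormedSpace ℝ E]
    (blk : X → 𝔅) (kQ kF : 𝔅 → X → E →L[ℝ] E) (sQ sF : X → E →L[ℝ] E) (r : ℝ) (c : 𝔅 → ℝ) :
    B9Eq360VprimeLetters.avgOp blk kQ kF sQ sF (r • c) = r • B9Eq360VprimeLetters.avgOp blk kQ kF sQ sF c := by
  simp only [B9Eq360VprimeLetters.avgOp, diagOp_smul, LinearMap.smul_comp, LinearMap.comp_smul, smul_add]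

/-- ★★ **(3.60) IN THE SHAPE OF THE SECT.-B FRAMES** (`B9SectBGpStepAtLettersV2.GpFrame₂.mul_law`: `Δp(U′U) = Δp(U) − V′`): with the `η⁻²`-RESCALED
letter `Δp(V) := η⁻²·Δ′_a(V)` (print's units) and the rescaled weight `η⁻²·cY`,
`η⁻²·Δ′_a(U′U) = η⁻²·Δ′_a(U) − vPrimeConc (shiftY i) (UboxY i U) η (chartA i A′) blkOf kQY kFY sQY sFY (η⁻²·cY)`.
[cite: Balaban1985BackgroundPropagators, (3.60) p.402, (3.24) p.394] -/
theorem eq360_deltaPrimeAY {η : ℝ} (hη : η ≠ 0) (A' : AfldY 𝔸 i) (U : CfgY 𝔸 i) :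
    (η ^ 2)⁻¹ • (deltaPrimeAY i par (mulY i (fluct η A') U)).restrictScalars ℝ
      = (η ^ 2)⁻¹ • (deltaPrimeAY i par U).restrictScalars ℝ
        - vPrimeConc (shiftY i) (UboxY i U) η (chartA i A') (blkY i) (kQY i par U) (kFY i par U (mulY i (fluct η A') U))
            (sQY i par U) (sFY i par U (mulY i (fluct η A') U)) ((η ^ 2)⁻¹ • cY i) := by
  have hη2 : (η ^ 2 : ℝ) ≠ 0 := pow_ne_zero 2 hη
  rw [deltaPrimeAY_mulY_fluct i par hη, vPrimeConc_eq, avgOp_smul_weight, smul_sub, smul_sub, smul_smul, inv_mul_cancel₀ hη2, one_smul]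

end Main

/-! ## §5 Relabeling the blocks (the frames index blocks by an injective image of `𝔅`) -/

section Reindex

variable {X 𝔅 𝔅' : Type*} [Fintype X] [DecidableEq 𝔅] [DecidableEq 𝔅'] {E : Type*} [NormedAddCommGroup E] [NormedSpace ℝ E]

/-- the kernel word read through an injective relabeling `ι` of the blocks (left inverse `ρ`): `K[k∘ρ]_{ι∘blk} μ (ι b) = K[k]_{blk} μ b`.
[cite: Balaban1985BackgroundPropagators, (3.19) p.393, bookkeeping] -/
theorem kerOp_reindex (blk : X → 𝔅) (ι : 𝔅 → 𝔅') (ρ : 𝔅' → 𝔅) (hρ : ∀ b, ρ (ι b) = b) (k : 𝔅 → X → E →L[ℝ] E) (μ : X → E) (b : 𝔅) :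
    kerOp (ι ∘ blk) (fun b' => k (ρ b')) μ (ι b) = kerOp blk k μ b := by
  have hinj : Function.Injective ι := Function.LeftInverse.injective hρ
  rw [kerOp_apply, kerOp_apply, hρ]
  refine Finset.sum_congr ?_ fun x _ => rfl
  ext x
  simp only [B9Eq360Vprime.block, Finset.mem_filter, Finset.mem_univ, true_and, Function.comp_apply, hinj.eq_iff]

/-- ★ the averaging words are INVARIANT under an injective relabeling of the blocks: `avgOp (ι∘blk) (kQ∘ρ) (kF∘ρ) sQ sF (c∘ρ) = avgOp blk kQ kF sQ sF c`.
[cite: Balaban1985BackgroundPropagators, (3.60) p.402, bookkeeping] -/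
theorem avgOp_reindex (blk : X → 𝔅) (ι : 𝔅 → 𝔅') (ρ : 𝔅' → 𝔅) (hρ : ∀ b, ρ (ι b) = b) (kQ kF : 𝔅 → X → E →L[ℝ] E)
    (sQ sF : X → E →L[ℝ] E) (c : 𝔅 → ℝ) :
    B9Eq360VprimeLetters.avgOp (ι ∘ blk) (fun b' => kQ (ρ b')) (fun b' => kF (ρ b')) sQ sF (fun b' => c (ρ b'))
      = B9Eq360VprimeLetters.avgOp blk kQ kF sQ sF c := by
  refine LinearMap.ext fun μ => funext fun x => ?_
  rw [B9Eq360VprimeLetters.avgOp_apply, B9Eq360VprimeLetters.avgOp_apply]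
  simp only [Function.comp_apply, hρ, kerOp_reindex blk ι ρ hρ]

end Reindex

section ReindexConc

variable {ι' : Type} [Fintype ι'] {S 𝔅 𝔅' : Type} [Fintype S] [DecidableEq 𝔅] [DecidableEq 𝔅'] {κ : Type} [Fintype κ]
  (T : κ → Equiv.Perm S) (U : κ → S → 𝔸ˣ)

omit [CompleteSpace 𝔸] in
/-- ★ r06's concrete `V′(A)` is invariant under an injective relabeling of the blocks. [cite: Balaban1985BackgroundPropagators, (3.60) p.402, bookkeeping] -/
theorem vPrimeConc_reindex (η : ℝ) (A : κ → S → 𝔸) (blk : S → 𝔅) (ι : 𝔅 → 𝔅') (ρ : 𝔅' → 𝔅) (hρ : ∀ b, ρ (ι b) = b)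
    (kQ kF : 𝔅 → S → 𝔸 →L[ℝ] 𝔸) (sQ sF : S → 𝔸 →L[ℝ] 𝔸) (c : 𝔅 → ℝ) :
    vPrimeConc T U η A (ι ∘ blk) (fun b' => kQ (ρ b')) (fun b' => kF (ρ b')) sQ sF (fun b' => c (ρ b'))
      = vPrimeConc T U η A blk kQ kF sQ sF c := by
  rw [vPrimeConc_eq, vPrimeConc_eq, avgOp_reindex blk ι ρ hρ]

end ReindexConc

end Literature.MathematicalPhysics.QuantumFieldTheory.Balaban1983to89.B9Eq360DeltaPrimeAY
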